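import Literature.AlgebraicGeometry.AbelianSchemes.PolarizedTupleIsomPiecesOfCharts    -- ★ (G2) `exists_isomPieces_of_charts`
import Literature.AlgebraicGeometry.AbelianSchemes.PolarizedTupleEmbeddingBaseChange   -- ★ (GS-3b3) `exists_iemb_of_tupleRel`
import Literature.AlgebraicGeometry.AbelianSchemes.TupleRelCancel                      -- ★ B-p18 `exists_tupleRel_baseChange_baseChange_of_comp_eq`, `exists_tupleRel_baseChange_of_tupleRel_comp`
import Literature.AlgebraicGeometry.Modules.SerreTwistModCoordinatePadding       -- ★ (b2′) LA4-p03 `SerreTwist.exists_projectiveSpace_padding` (ED. 3)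
import Mathlib.AlgebraicGeometry.Noetherian
import HarnessLib

/-!
# The iso-locus of ONE PEL tuple AT TWO POINTS is covered by finitely many finite-type pieces over `Y ×_B Y`, from a projective-embedding ATLAS of the
# base `Y` (organ (GS-3b0) of the `stub_INJ0` payer: the `hpieces` hypothesis of ★ (GS-3) for one global family)

Topic `AlgebraicGeometry/AbelianSchemes`; namespace `Literature.AlgebraicGeometry.AbelianSchemes.AbelianSchemeOver`.  THEOREMS ONLY (no definition, no
instance, no notation, no named fact, no `sorry`); universe `Scheme.{0}`.  Cell `hodgecm-mathlib` (D-0151), P6 «MOD programme» (crux hLiu418 =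
stmt-HodgeConjecture-24832, `--supports`, count-neutral); P-LINE ED. 2 leaf `Lines/F0_P6a_PELSpread.lean` socket `stub_INJ0` (LEAD F0P6-plan (g3) «M-55», desk
memo `MEMO-PLINE-ED2-stubSPREAD.v1` §2, census `CENSUS-stubINJ0-globalfamily.v2` §4 row (b0)).  HC_CM is proved only modulo the printed citations until rung 0
closes; nothing here is about HC.

THE MATHEMATICS ([MumfordFogartyKirwan1994] Ch. 7 §2 Prop. 7.3 and Thm. 7.9; [GortzWedhorn2020] (4.7)).  ★ (G2) `exists_isomPieces_of_charts` covers the iso-locus of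
TWO tuples over a base by finitely many finite-type pieces, given on a finite atlas of the base projective embeddings of both tuples into ONE `𝐏(Fin n)` with
`𝒪(1)| ≅ L^Δ(λ)^{⊗k}`.  For the `inj₀` law one compares ONE tuple `(𝒜, ι, Â, 𝒫, λ, lvl)` over `Y → Spec B` with ITSELF at two points, i.e. the two tuples
`pr₁^*𝒜`, `pr₂^*𝒜` over `Y ×_B Y`; an atlas `c_α : Yc α → Y` of embeddings of `c_α^*𝒜` (★ REL-EMB-SPREAD, padded to a common `n`) yields the PRODUCT atlas
`Yc α ×_B Yc β → Y ×_B Y`, on which the embedding data of `pr₁^*𝒜` resp. `pr₂^*𝒜` are those of `c_α^*𝒜` resp. `c_β^*𝒜` moved along the pull-back relations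
`(pr₁^*𝒜)|_{αβ} → c_α^*𝒜` over `Yc α ×_B Yc β → Yc α` (★ B-p18 `TupleRelCancel` §1 + §3 for the relation, ★ (GS-3b3) `exists_iemb_of_tupleRel` for the data).

* `exists_isomPieces_of_atlas` — THE HEAD: `hpieces` of ★ (GS-3) `exists_finset_forall_eq_of_tupleIsoAt` VERBATIM, from an (I-EMB) atlas of `Y` (common `n ≥ 1`, `k`).
* `exists_isomPieces_of_forall_exists_chart` — ED. 2: the same from Noetherian OPEN charts through every point of a compact `Y` (finite sub-atlas).
* `exists_isomPieces_of_forall_exists_chart'` — ED. 3: chart-dependent `𝐏(Fin (m+1))`, padded to a common `n` by ★ (b2′) after the finite sub-atlas.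

## References
* [MumfordFogartyKirwan1994] D. Mumford, J. Fogarty, F. Kirwan, *Geometric Invariant Theory*, 3rd ed. (1994), Ch. 7 §2 Prop. 7.3 (p. 132), §3 Thm. 7.9 (p. 139).
* [GortzWedhorn2020] U. Görtz, T. Wedhorn, *Algebraic Geometry I*, 2nd ed. (2020), Section (4.7) (pp. 107–108), Prop. 4.16 (p. 101).
* [RapoportSmithlingZhang2020Diagonal] M. Rapoport, B. Smithling, W. Zhang, Compos. Math. 156 (2020), §4.1 Thm. 4.1 (p. 17).
-/

set_option autoImplicit false

noncomputable section

-- Mathlib's `Over`/pull-back API is stated across semireducible wrappers (as in the ★ `AbelianSchemes/*` files).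
set_option backward.isDefEq.respectTransparency false

open CategoryTheory CategoryTheory.Limits AlgebraicGeometry

namespace Literature.AlgebraicGeometry.AbelianSchemes

namespace AbelianSchemeOver

open Literature.AlgebraicGeometry Literature.AlgebraicGeometry.Morphisms
open Literature.AlgebraicGeometry.Motives Literature.AlgebraicGeometry.Modules Literature.AlgebraicGeometry.Modules.SerreTwist
open Literature.AlgebraicGeometry.AbelianVarieties

/-- **(GS-3b0) THE ISO-LOCUS OF ONE TUPLE AT TWO POINTS IS COVERED BY FINITELY MANY FINITE-TYPE PIECES, FROM AN EMBEDDING ATLAS OF THE BASE.**  Let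
`q : Y → Spec B` be quasi-compact and locally of finite type, `(𝒜, ι, Â, 𝒫, λ, lvl)` a tuple over `Y`, and `c_α : Yc α → Y` (`α : ι`, finite) Noetherian charts
covering the geometric points of `Y`, each with an (I-EMB) datum of `c_α^*𝒜`: graph `Gr_α = (1, λ)`, closed `Yc α`-immersion `j_α : c_α^*𝒜 ↪ 𝐏(Fin n; Yc α)`
(ONE `n ≥ 1` for all charts) and `e_α : 𝒪(1)| ≅ L^Δ(λ)^{⊗k}` (ONE `k`).  Then the locus of geometric points `t` of `Y ×_B Y` at which the tuples `pr₁^*𝒜`, `pr₂^*𝒜`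
are isomorphic is the union of the images of finitely many quasi-compact finite-type `Y ×_B Y`-schemes — VERBATIM the hypothesis `hpieces` of ★ (GS-3)
`exists_finset_forall_eq_of_tupleIsoAt` (★ (G2) on the product atlas `Yc α ×_B Yc β`, its data by ★ (GS-3b3) along the relations of ★ `TupleRelCancel`).
[cite: MumfordFogartyKirwan1994, Ch. 7 §2 Prop. 7.3 (p. 132) and §3 Theorem 7.9 (p. 139)] [cite: GortzWedhorn2020, Section (4.7) (pp. 107–108)]
[cite: RapoportSmithlingZhang2020Diagonal, §4.1 Thm. 4.1 p. 17] -/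
theorem exists_isomPieces_of_atlas {B : Type} [CommRing B] {Y : Scheme.{0}} (q : Y ⟶ Spec (CommRingCat.of B)) [QuasiCompact q]
    [LocallyOfFiniteType q] {O : Type} [CommRing O]
    (𝒜 : AbelianSchemeOver Y) (ρ : RingAction O 𝒜) (D : 𝒜.DualPair) (pol : 𝒜.Polarization D) {g N : ℕ} (lvl : 𝒜.LevelStructure g N)
    {ι : Type} [Fintype ι] (Yc : ι → Scheme.{0}) [∀ α, IsNoetherian (Yc α)] (c : ∀ α, Yc α ⟶ Y)
    [∀ α, QuasiCompact (c α)] [∀ α, LocallyOfFiniteType (c α)]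
    (hcov : ∀ ⦃Ω : Type⦄ [Field Ω] [IsAlgClosed Ω] (y : Spec (CommRingCat.of Ω) ⟶ Y), ∃ (α : ι) (y' : Spec (CommRingCat.of Ω) ⟶ Yc α), y' ≫ c α = y)
    {n k : ℕ} (hn : 1 ≤ n)
    (Gr : ∀ α, (𝒜.baseChange (c α)).X.left ⟶ (𝒜.baseChange (c α)).prodLeft (D.baseChange (c α)).hat)
    (hGr₁ : ∀ α, Gr α ≫ pullback.fst (𝒜.baseChange (c α)).X.hom (D.baseChange (c α)).hat.X.hom = 𝟙 _)
    (hGr₂ : ∀ α, Gr α ≫ pullback.snd (𝒜.baseChange (c α)).X.hom (D.baseChange (c α)).hat.X.hom = (pol.baseChange (c α)).lam.left)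
    (j : ∀ α, (𝒜.baseChange (c α)).X.left ⟶ Morphisms.projectiveSpace (Fin n) (Yc α))
    (hj : ∀ α, j α ≫ Morphisms.projectiveSpaceFst (Fin n) (Yc α) = (𝒜.baseChange (c α)).X.hom) (hjc : ∀ α, IsClosedImmersion (j α))
    (e : ∀ α, twistMod (j α ≫ pullback.snd (terminal.from (Yc α)) (terminal.from (Morphisms.projectiveSpaceInt (Fin n)))) (unitModule _) 1 ≅
      tensorPow ((Scheme.Modules.pullback (Gr α)).obj (D.baseChange (c α)).P) k) :
    ∃ (r : ℕ) (I : Fin r → Scheme.{0}) (f : ∀ i, I i ⟶ pullback q q) (_ : ∀ i, QuasiCompact (f i))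
      (_ : ∀ i, LocallyOfFiniteType (f i)),
      ∀ ⦃Ω : Type⦄ [Field Ω] [IsAlgClosed Ω] (t : Spec (CommRingCat.of Ω) ⟶ pullback q q),
        (∃ (G : ((𝒜.baseChange (pullback.fst q q)).baseChange t).X.left ⟶ ((𝒜.baseChange (pullback.snd q q)).baseChange t).X.left)
            (Ĝ : ((D.baseChange (pullback.fst q q)).baseChange t).hat.X.left ⟶ ((D.baseChange (pullback.snd q q)).baseChange t).hat.X.left),
          ((lvl.baseChange (pullback.fst q q)).baseChange t).IsBaseChangeVia ((lvl.baseChange (pullback.snd q q)).baseChange t)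
              (𝟙 (Spec (CommRingCat.of Ω))) G ∧
          ((D.baseChange (pullback.fst q q)).baseChange t).hat.IsBaseChangeVia ((D.baseChange (pullback.snd q q)).baseChange t).hat
              (𝟙 (Spec (CommRingCat.of Ω))) Ĝ ∧
          (∃ (wG : ((𝒜.baseChange (pullback.fst q q)).baseChange t).X.hom ≫ 𝟙 (Spec (CommRingCat.of Ω)) =
                G ≫ ((𝒜.baseChange (pullback.snd q q)).baseChange t).X.hom)
              (wĜ : ((D.baseChange (pullback.fst q q)).baseChange t).hat.X.hom ≫ 𝟙 (Spec (CommRingCat.of Ω)) =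
                Ĝ ≫ ((D.baseChange (pullback.snd q q)).baseChange t).hat.X.hom),
            Nonempty ((Scheme.Modules.pullback
              (pullback.map ((𝒜.baseChange (pullback.fst q q)).baseChange t).X.hom ((D.baseChange (pullback.fst q q)).baseChange t).hat.X.hom
                ((𝒜.baseChange (pullback.snd q q)).baseChange t).X.hom ((D.baseChange (pullback.snd q q)).baseChange t).hat.X.hom
                G Ĝ (𝟙 (Spec (CommRingCat.of Ω))) wG wĜ)).obj ((D.baseChange (pullback.snd q q)).baseChange t).P ≅
              ((D.baseChange (pullback.fst q q)).baseChange t).P)) ∧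
          ((pol.baseChange (pullback.fst q q)).baseChange t).lam.left ≫ Ĝ = G ≫ ((pol.baseChange (pullback.snd q q)).baseChange t).lam.left ∧
          ∀ a : O, (baseChangeHom ((ρ.baseChange (pullback.fst q q)).i a) t).left ≫ G =
            G ≫ (baseChangeHom ((ρ.baseChange (pullback.snd q q)).i a) t).left) ↔
        ∃ (i : Fin r) (s : Spec (CommRingCat.of Ω) ⟶ I i), s ≫ f i = t := by
  classical
  -- THE PRODUCT ATLAS `Yc α ×_B Yc β → Y ×_B Y`
  let Ycc : ι × ι → Scheme.{0} := fun ab => pullback (c ab.1 ≫ q) (c ab.2 ≫ q)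
  let cc : ∀ ab : ι × ι, Ycc ab ⟶ pullback q q := fun ab =>
    pullback.map (c ab.1 ≫ q) (c ab.2 ≫ q) q q (c ab.1) (c ab.2) (𝟙 _) (by rw [Category.comp_id]) (by rw [Category.comp_id])
  have hcc₁ : ∀ ab, cc ab ≫ pullback.fst q q = pullback.fst _ _ ≫ c ab.1 := fun ab => pullback.lift_fst _ _ _
  have hcc₂ : ∀ ab, cc ab ≫ pullback.snd q q = pullback.snd _ _ ≫ c ab.2 := fun ab => pullback.lift_snd _ _ _
  haveI : ∀ ab : ι × ι, IsNoetherian (Ycc ab) := fun ab =>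
    { toIsLocallyNoetherian := inferInstance, toCompactSpace := inferInstance }
  haveI hccl : ∀ ab : ι × ι, LocallyOfFiniteType (cc ab) := fun ab => by
    have h : LocallyOfFiniteType (cc ab ≫ (pullback.fst q q ≫ q)) := by
      rw [← Category.assoc, hcc₁, Category.assoc]; infer_instance
    exact locallyOfFiniteType_of_comp (cc ab) (pullback.fst q q ≫ q)
  have hcov' : ∀ ⦃Ω : Type⦄ [Field Ω] [IsAlgClosed Ω] (t : Spec (CommRingCat.of Ω) ⟶ pullback q q),
      ∃ (ab : ι × ι) (t' : Spec (CommRingCat.of Ω) ⟶ Ycc ab), t' ≫ cc ab = t := by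
    intro Ω _ _ t
    obtain ⟨α, y₁, hy₁⟩ := hcov (t ≫ pullback.fst q q)
    obtain ⟨β, y₂, hy₂⟩ := hcov (t ≫ pullback.snd q q)
    have w : y₁ ≫ c α ≫ q = y₂ ≫ c β ≫ q := by
      rw [reassoc_of% hy₁, reassoc_of% hy₂, pullback.condition]
    refine ⟨(α, β), pullback.lift y₁ y₂ w, ?_⟩
    apply pullback.hom_ext
    · rw [Category.assoc, hcc₁, pullback.lift_fst_assoc, hy₁]
    · rw [Category.assoc, hcc₂, pullback.lift_snd_assoc, hy₂]
  -- THE RELATIONS `(prᵢ^*𝒜)|_{αβ} → c^*𝒜` over the projections of the product chart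
  -- first tuple: along `pr₁′ : Ycc ab → Yc ab.1`
  have data : ∀ (ab : ι × ι) (γ : ι) (pr : pullback q q ⟶ Y) (p : Ycc ab ⟶ Yc γ) (hp : cc ab ≫ pr = p ≫ c γ),
      ∃ (Gr' : ((𝒜.baseChange pr).baseChange (cc ab)).X.left ⟶ ((𝒜.baseChange pr).baseChange (cc ab)).prodLeft ((D.baseChange pr).baseChange (cc ab)).hat)
        (j' : ((𝒜.baseChange pr).baseChange (cc ab)).X.left ⟶ Morphisms.projectiveSpace (Fin n) (Ycc ab)),
        Gr' ≫ pullback.fst _ _ = 𝟙 _ ∧ Gr' ≫ pullback.snd _ _ = ((pol.baseChange pr).baseChange (cc ab)).lam.left ∧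
        j' ≫ Morphisms.projectiveSpaceFst (Fin n) (Ycc ab) = ((𝒜.baseChange pr).baseChange (cc ab)).X.hom ∧ IsClosedImmersion j' ∧
        Nonempty (twistMod (j' ≫ pullback.snd (terminal.from (Ycc ab)) (terminal.from (Morphisms.projectiveSpaceInt (Fin n)))) (unitModule _) 1 ≅
          tensorPow ((Scheme.Modules.pullback Gr').obj ((D.baseChange pr).baseChange (cc ab)).P) k) := by
    intro ab γ pr p hp
    -- iterated → single along `cc ≫ pr = p ≫ c γ`, then the canonical relation of `𝒜 ×_Y (p ≫ c γ)` to `𝒜`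
    obtain ⟨H, Ĥ, h₁⟩ := exists_tupleRel_baseChange_baseChange_of_comp_eq 𝒜 ρ D pol lvl pr (cc ab) (p ≫ c γ) hp
    have h₂ := tupleRel_baseChange_fst 𝒜 ρ D pol lvl (p ≫ c γ)
    have h := tupleRel_trans h₁ h₂
    rw [Category.id_comp] at h
    -- factor through THE base change along `c γ`
    obtain ⟨G', Ĝ', -, -, hrel⟩ := exists_tupleRel_baseChange_of_tupleRel_comp 𝒜 ρ D pol lvl (c γ) p h
    obtain ⟨hl, -, ⟨wG, wĜ, hP⟩, hlam, -⟩ := hrel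
    haveI := hjc γ
    obtain ⟨Gr', j', h1, h2, h3, h4, h5⟩ := exists_iemb_of_tupleRel p (D.baseChange (c γ)) ((D.baseChange pr).baseChange (cc ab))
      (pol.baseChange (c γ)).lam ((pol.baseChange pr).baseChange (cc ab)).lam hl.1 wG wĜ hP hlam (Gr γ) (hGr₁ γ) (hGr₂ γ) (j γ) (hj γ) (e γ)
    exact ⟨Gr', j', h1, h2, h3, h4, h5⟩
  choose Gr₁ j₁ hGr₁₁ hGr₁₂ hj₁ hj₁c e₁ using fun ab : ι × ι =>
    data ab ab.1 (pullback.fst q q) (pullback.fst _ _) (hcc₁ ab)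
  choose Gr₂ j₂ hGr₂₁ hGr₂₂ hj₂ hj₂c e₂ using fun ab : ι × ι =>
    data ab ab.2 (pullback.snd q q) (pullback.snd _ _) (hcc₂ ab)
  -- ★ (G2) ON THE PRODUCT ATLAS
  exact exists_isomPieces_of_charts (𝒜.baseChange (pullback.fst q q)) (ρ.baseChange (pullback.fst q q)) (D.baseChange (pullback.fst q q))
    (pol.baseChange (pullback.fst q q)) (lvl.baseChange (pullback.fst q q)) (𝒜.baseChange (pullback.snd q q)) (ρ.baseChange (pullback.snd q q))
    (D.baseChange (pullback.snd q q)) (pol.baseChange (pullback.snd q q)) (lvl.baseChange (pullback.snd q q)) Ycc cc hcov'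
    (fun _ => n) (fun _ => k) (fun _ => hn) Gr₁ Gr₂ hGr₁₁ hGr₁₂ hGr₂₁ hGr₂₂ j₁ hj₁ j₂ hj₂ hj₁c hj₂c (fun ab => (e₁ ab).some) (fun ab => (e₂ ab).some)

/-- **(GS-3b0′) THE SAME, FROM NOETHERIAN OPEN CHARTS THROUGH EVERY POINT OF A COMPACT BASE** ((b0) + (b4) finite sub-atlas): `Y` quasi-compact (as a
space), and through every point `y ∈ Y` an OPEN IMMERSION `c : Yc → Y` from a Noetherian scheme carrying an (I-EMB) datum of `c^*𝒜` with the common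
`(n, k)` — the shape in which ★ REL-EMB-SPREAD `exists_opens_finite_image_compl_forall_affineOpen_isClosedImmersion_toProj` delivers its charts, once
converted to (I-EMB) currency and padded.  Then `hpieces` of ★ (GS-3) holds for `𝒜`: finitely many ranges cover `Y` (Mathlib `IsCompact.elim_finite_subcover`),
geometric points lift through the open immersions (`IsOpenImmersion.lift`), and ★ `exists_isomPieces_of_atlas` applies to the finite atlas.
[cite: MumfordFogartyKirwan1994, Ch. 7 §2 Prop. 7.3 (p. 132) and §3 Theorem 7.9 (p. 139)] [cite: GortzWedhorn2020, Section (4.7) (pp. 107–108)] -/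
theorem exists_isomPieces_of_forall_exists_chart {B : Type} [CommRing B] {Y : Scheme.{0}} (q : Y ⟶ Spec (CommRingCat.of B)) [QuasiCompact q]
    [LocallyOfFiniteType q] [CompactSpace ↥Y] {O : Type} [CommRing O]
    (𝒜 : AbelianSchemeOver Y) (ρ : RingAction O 𝒜) (D : 𝒜.DualPair) (pol : 𝒜.Polarization D) {g N : ℕ} (lvl : 𝒜.LevelStructure g N)
    {n k : ℕ} (hn : 1 ≤ n)
    (hchart : ∀ y : ↥Y, ∃ (Yc : Scheme.{0}) (_ : IsNoetherian Yc) (c : Yc ⟶ Y) (_ : IsOpenImmersion c), y ∈ Set.range c.base ∧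
      ∃ (Gr : (𝒜.baseChange c).X.left ⟶ (𝒜.baseChange c).prodLeft (D.baseChange c).hat)
        (j : (𝒜.baseChange c).X.left ⟶ Morphisms.projectiveSpace (Fin n) Yc),
        Gr ≫ pullback.fst (𝒜.baseChange c).X.hom (D.baseChange c).hat.X.hom = 𝟙 _ ∧
        Gr ≫ pullback.snd (𝒜.baseChange c).X.hom (D.baseChange c).hat.X.hom = (pol.baseChange c).lam.left ∧
        j ≫ Morphisms.projectiveSpaceFst (Fin n) Yc = (𝒜.baseChange c).X.hom ∧ IsClosedImmersion j ∧
        Nonempty (twistMod (j ≫ pullback.snd (terminal.from Yc) (terminal.from (Morphisms.projectiveSpaceInt (Fin n)))) (unitModule _) 1 ≅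
          tensorPow ((Scheme.Modules.pullback Gr).obj (D.baseChange c).P) k)) :
    ∃ (r : ℕ) (I : Fin r → Scheme.{0}) (f : ∀ i, I i ⟶ pullback q q) (_ : ∀ i, QuasiCompact (f i))
      (_ : ∀ i, LocallyOfFiniteType (f i)),
      ∀ ⦃Ω : Type⦄ [Field Ω] [IsAlgClosed Ω] (t : Spec (CommRingCat.of Ω) ⟶ pullback q q),
        (∃ (G : ((𝒜.baseChange (pullback.fst q q)).baseChange t).X.left ⟶ ((𝒜.baseChange (pullback.snd q q)).baseChange t).X.left)
            (Ĝ : ((D.baseChange (pullback.fst q q)).baseChange t).hat.X.left ⟶ ((D.baseChange (pullback.snd q q)).baseChange t).hat.X.left),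
          ((lvl.baseChange (pullback.fst q q)).baseChange t).IsBaseChangeVia ((lvl.baseChange (pullback.snd q q)).baseChange t)
              (𝟙 (Spec (CommRingCat.of Ω))) G ∧
          ((D.baseChange (pullback.fst q q)).baseChange t).hat.IsBaseChangeVia ((D.baseChange (pullback.snd q q)).baseChange t).hat
              (𝟙 (Spec (CommRingCat.of Ω))) Ĝ ∧
          (∃ (wG : ((𝒜.baseChange (pullback.fst q q)).baseChange t).X.hom ≫ 𝟙 (Spec (CommRingCat.of Ω)) =
                G ≫ ((𝒜.baseChange (pullback.snd q q)).baseChange t).X.hom)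
              (wĜ : ((D.baseChange (pullback.fst q q)).baseChange t).hat.X.hom ≫ 𝟙 (Spec (CommRingCat.of Ω)) =
                Ĝ ≫ ((D.baseChange (pullback.snd q q)).baseChange t).hat.X.hom),
            Nonempty ((Scheme.Modules.pullback
              (pullback.map ((𝒜.baseChange (pullback.fst q q)).baseChange t).X.hom ((D.baseChange (pullback.fst q q)).baseChange t).hat.X.hom
                ((𝒜.baseChange (pullback.snd q q)).baseChange t).X.hom ((D.baseChange (pullback.snd q q)).baseChange t).hat.X.hom
                G Ĝ (𝟙 (Spec (CommRingCat.of Ω))) wG wĜ)).obj ((D.baseChange (pullback.snd q q)).baseChange t).P ≅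
              ((D.baseChange (pullback.fst q q)).baseChange t).P)) ∧
          ((pol.baseChange (pullback.fst q q)).baseChange t).lam.left ≫ Ĝ = G ≫ ((pol.baseChange (pullback.snd q q)).baseChange t).lam.left ∧
          ∀ a : O, (baseChangeHom ((ρ.baseChange (pullback.fst q q)).i a) t).left ≫ G =
            G ≫ (baseChangeHom ((ρ.baseChange (pullback.snd q q)).i a) t).left) ↔
        ∃ (i : Fin r) (s : Spec (CommRingCat.of Ω) ⟶ I i), s ≫ f i = t := by
  classical
  choose Yc hN c hc hy hdata using hchart
  -- the ranges of the charts cover the compact `Y`: a finite sub-atlas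
  have hcover : (Set.univ : Set ↥Y) ⊆ ⋃ y, Set.range (c y).base := fun y _ => Set.mem_iUnion.mpr ⟨y, hy y⟩
  obtain ⟨s, hs⟩ := isCompact_univ.elim_finite_subcover (fun y => Set.range (c y).base)
    (fun y => (c y).isOpenEmbedding.isOpen_range) hcover
  haveI : ∀ y : ↥s, IsNoetherian (Yc y) := fun y => hN y
  haveI : ∀ y : ↥s, IsOpenImmersion (c y) := fun y => hc y
  -- geometric points lift through the open chart containing their image
  have hcov : ∀ ⦃Ω : Type⦄ [Field Ω] [IsAlgClosed Ω] (x : Spec (CommRingCat.of Ω) ⟶ Y),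
      ∃ (α : ↥s) (x' : Spec (CommRingCat.of Ω) ⟶ Yc α), x' ≫ c α = x := by
    intro Ω _ _ x
    have hx := hs (Set.mem_univ (x.base (IsLocalRing.closedPoint Ω)))
    obtain ⟨y, hy', hxy⟩ := Set.mem_iUnion₂.mp hx
    have hrange : Set.range x.base ⊆ Set.range (c y).base := by
      rintro _ ⟨p, rfl⟩
      obtain rfl : p = IsLocalRing.closedPoint Ω := Subsingleton.elim _ _
      exact hxy
    haveI := hc y
    exact ⟨⟨y, hy'⟩, IsOpenImmersion.lift (c y) x hrange, IsOpenImmersion.lift_fac _ _ _⟩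
  choose Gr j hGr₁ hGr₂ hj hjc e using hdata
  exact exists_isomPieces_of_atlas q 𝒜 ρ D pol lvl (fun y : ↥s => Yc y) (fun y => c y) hcov hn (fun y => Gr y) (fun y => hGr₁ y)
    (fun y => hGr₂ y) (fun y => j y) (fun y => hj y) (fun y => hjc y) (fun y => (e y).some)

/-- **(GS-3b0″) THE SAME WITH CHART-DEPENDENT PROJECTIVE DIMENSIONS** ((b0′) + ★ (b2′) padding): through every point of the compact `Y` a Noetherian
open chart `c : Yc → Y` with an (I-EMB) datum of `c^*𝒜` into SOME `𝐏(Fin (m+1); Yc)` (`m` depending on the chart — the shape delivered by ★ REL-EMB-SPREAD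
`…_toProj'` after the `toProj ↦ (I-EMB)` conversion), common tensor exponent `k`.  A finite sub-atlas is chosen FIRST, then every chart is padded into
`𝐏(Fin n)` with `n := 1 + max m` by ★ `SerreTwist.exists_projectiveSpace_padding` (closed immersion over the chart, `𝒪(1) ↦ 𝒪(1)`), then ★
`exists_isomPieces_of_atlas`. [cite: MumfordFogartyKirwan1994, Ch. 7 §2 Prop. 7.3 (p. 132) and §3 Theorem 7.9 (p. 139)] [cite: Hartshorne1977, II Ex. 3.12 (a) and II Prop. 5.12 (c)] -/
theorem exists_isomPieces_of_forall_exists_chart' {B : Type} [CommRing B] {Y : Scheme.{0}} (q : Y ⟶ Spec (CommRingCat.of B)) [QuasiCompact q]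
    [LocallyOfFiniteType q] [CompactSpace ↥Y] {O : Type} [CommRing O]
    (𝒜 : AbelianSchemeOver Y) (ρ : RingAction O 𝒜) (D : 𝒜.DualPair) (pol : 𝒜.Polarization D) {g N : ℕ} (lvl : 𝒜.LevelStructure g N) {k : ℕ}
    (hchart : ∀ y : ↥Y, ∃ (Yc : Scheme.{0}) (_ : IsNoetherian Yc) (c : Yc ⟶ Y) (_ : IsOpenImmersion c), y ∈ Set.range c.base ∧
      ∃ (m : ℕ) (Gr : (𝒜.baseChange c).X.left ⟶ (𝒜.baseChange c).prodLeft (D.baseChange c).hat)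
        (j : (𝒜.baseChange c).X.left ⟶ Morphisms.projectiveSpace (Fin (m + 1)) Yc),
        Gr ≫ pullback.fst (𝒜.baseChange c).X.hom (D.baseChange c).hat.X.hom = 𝟙 _ ∧
        Gr ≫ pullback.snd (𝒜.baseChange c).X.hom (D.baseChange c).hat.X.hom = (pol.baseChange c).lam.left ∧
        j ≫ Morphisms.projectiveSpaceFst (Fin (m + 1)) Yc = (𝒜.baseChange c).X.hom ∧ IsClosedImmersion j ∧
        Nonempty (twistMod (j ≫ pullback.snd (terminal.from Yc) (terminal.from (Morphisms.projectiveSpaceInt (Fin (m + 1)))))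
          (unitModule _) 1 ≅ tensorPow ((Scheme.Modules.pullback Gr).obj (D.baseChange c).P) k)) :
    ∃ (r : ℕ) (I : Fin r → Scheme.{0}) (f : ∀ i, I i ⟶ pullback q q) (_ : ∀ i, QuasiCompact (f i))
      (_ : ∀ i, LocallyOfFiniteType (f i)),
      ∀ ⦃Ω : Type⦄ [Field Ω] [IsAlgClosed Ω] (t : Spec (CommRingCat.of Ω) ⟶ pullback q q),
        (∃ (G : ((𝒜.baseChange (pullback.fst q q)).baseChange t).X.left ⟶ ((𝒜.baseChange (pullback.snd q q)).baseChange t).X.left)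
            (Ĝ : ((D.baseChange (pullback.fst q q)).baseChange t).hat.X.left ⟶ ((D.baseChange (pullback.snd q q)).baseChange t).hat.X.left),
          ((lvl.baseChange (pullback.fst q q)).baseChange t).IsBaseChangeVia ((lvl.baseChange (pullback.snd q q)).baseChange t)
              (𝟙 (Spec (CommRingCat.of Ω))) G ∧
          ((D.baseChange (pullback.fst q q)).baseChange t).hat.IsBaseChangeVia ((D.baseChange (pullback.snd q q)).baseChange t).hat
              (𝟙 (Spec (CommRingCat.of Ω))) Ĝ ∧
          (∃ (wG : ((𝒜.baseChange (pullback.fst q q)).baseChange t).X.hom ≫ 𝟙 (Spec (CommRingCat.of Ω)) =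
                G ≫ ((𝒜.baseChange (pullback.snd q q)).baseChange t).X.hom)
              (wĜ : ((D.baseChange (pullback.fst q q)).baseChange t).hat.X.hom ≫ 𝟙 (Spec (CommRingCat.of Ω)) =
                Ĝ ≫ ((D.baseChange (pullback.snd q q)).baseChange t).hat.X.hom),
            Nonempty ((Scheme.Modules.pullback
              (pullback.map ((𝒜.baseChange (pullback.fst q q)).baseChange t).X.hom ((D.baseChange (pullback.fst q q)).baseChange t).hat.X.hom
                ((𝒜.baseChange (pullback.snd q q)).baseChange t).X.hom ((D.baseChange (pullback.snd q q)).baseChange t).hat.X.hom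
                G Ĝ (𝟙 (Spec (CommRingCat.of Ω))) wG wĜ)).obj ((D.baseChange (pullback.snd q q)).baseChange t).P ≅
              ((D.baseChange (pullback.fst q q)).baseChange t).P)) ∧
          ((pol.baseChange (pullback.fst q q)).baseChange t).lam.left ≫ Ĝ = G ≫ ((pol.baseChange (pullback.snd q q)).baseChange t).lam.left ∧
          ∀ a : O, (baseChangeHom ((ρ.baseChange (pullback.fst q q)).i a) t).left ≫ G =
            G ≫ (baseChangeHom ((ρ.baseChange (pullback.snd q q)).i a) t).left) ↔
        ∃ (i : Fin r) (s : Spec (CommRingCat.of Ω) ⟶ I i), s ≫ f i = t := by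
  classical
  choose Yc hN c hc hy m Gr j hGr₁ hGr₂ hj hjc e using hchart
  -- the ranges of the charts cover the compact `Y`: a finite sub-atlas
  have hcover : (Set.univ : Set ↥Y) ⊆ ⋃ y, Set.range (c y).base := fun y _ => Set.mem_iUnion.mpr ⟨y, hy y⟩
  obtain ⟨s, hs⟩ := isCompact_univ.elim_finite_subcover (fun y => Set.range (c y).base)
    (fun y => (c y).isOpenEmbedding.isOpen_range) hcover
  haveI : ∀ y : ↥s, IsNoetherian (Yc y) := fun y => hN y
  haveI : ∀ y : ↥s, IsOpenImmersion (c y) := fun y => hc y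
  have hcov : ∀ ⦃Ω : Type⦄ [Field Ω] [IsAlgClosed Ω] (x : Spec (CommRingCat.of Ω) ⟶ Y),
      ∃ (α : ↥s) (x' : Spec (CommRingCat.of Ω) ⟶ Yc α), x' ≫ c α = x := by
    intro Ω _ _ x
    have hx := hs (Set.mem_univ (x.base (IsLocalRing.closedPoint Ω)))
    obtain ⟨y, hy', hxy⟩ := Set.mem_iUnion₂.mp hx
    have hrange : Set.range x.base ⊆ Set.range (c y).base := by
      rintro _ ⟨p, rfl⟩
      obtain rfl : p = IsLocalRing.closedPoint Ω := Subsingleton.elim _ _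
      exact hxy
    haveI := hc y
    exact ⟨⟨y, hy'⟩, IsOpenImmersion.lift (c y) x hrange, IsOpenImmersion.lift_fac _ _ _⟩
  -- PAD every chart of the finite sub-atlas into `𝐏(Fin n)`, `n := 1 + max m`
  let n : ℕ := (s.sup fun y => m y) + 1
  have hle : ∀ y : ↥s, Nat.card (Fin (m y + 1)) ≤ Nat.card (Fin n) := fun y => by
    rw [Nat.card_fin, Nat.card_fin]
    exact Nat.succ_le_succ (Finset.le_sup (f := fun y : ↥Y => m y) y.2)
  choose P hPc hPfst hPiso using fun y : ↥s => SerreTwist.exists_projectiveSpace_padding (hle y) (Yc y)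
  haveI : ∀ y : ↥s, IsClosedImmersion (j y) := fun y => hjc y
  refine exists_isomPieces_of_atlas q 𝒜 ρ D pol lvl (fun y : ↥s => Yc y) (fun y => c y) hcov (n := n) (k := k) (Nat.succ_le_succ (Nat.zero_le _))
    (fun y => Gr y) (fun y => hGr₁ y) (fun y => hGr₂ y) (fun y => j y ≫ P y) (fun y => ?_) (fun y => ?_) (fun y => ?_)
  · rw [Category.assoc, hPfst, hj]
  · haveI := hPc y
    infer_instance
  · exact (hPiso y (j y) (unitModule _) 1).some ≪≫ (e y).some

end AbelianSchemeOver

end Literature.AlgebraicGeometry.AbelianSchemes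

end
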